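import Literature.MathematicalPhysics.QuantumLattice.DWaveSourceWindowCertificateFieldRows
import HarnessLib

/-!
# The Griffiths chord IS a window certificate: an end-to-end instance of the sourced certificate readers
# (the identity with a cap row at `h`, a floor row at `h₁`, and no other block — proved, not assumed)

Topic `Literature/MathematicalPhysics/QuantumLattice` (namespace = path); cell `hubbard-cq`, seat `hubbard-cq-obsth-1`
(row «pinning-field K5 menu nodes with the pinning term»). The readers of `DWaveSourceTIClassWindowCertificate`,
`DWaveSourceGSClassWindowCertificate`, `DWaveSourceWindowCertificateFieldRows` take a dual identity in the window algebra `𝔄_{Λ'}` as a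
HYPOTHESIS; no identity had been instantiated in the tree. This file exhibits one and runs it through the readers: the cell's
Griffiths CHORD. Along the Koma–Tasaki pencil `Φ − μn − hP_d` the mean-energy observables satisfy, as OPERATORS in the window,

  `Γ E^{src}_{h₁} − Γ E^{src}_{h} = (h − h₁) • Γ E_P`,  `E_P = (pairSourceInteraction dWaveFormFactor).meanEnergyObs 1`

(`fermionEmbed_meanEnergyObs_sourced_sub`; `Re ω(Γ E_P) = 2 Re ω(P₀^d)` in every state). Hence the identity of the field-rows readers
with window `thicken {0} 1`, objective `Xw = (h − h₁) • Γ E_P`, constant `c = ℓ₁ − u`, the cap row `1·(u·1 − Γ E^{src}_h)`, ONE floor row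
`1·(Γ E^{src}_{h₁} − ℓ₁·1)`, and EVERY OTHER BLOCK EMPTY (`0 × 0` Gram and KKT blocks, no `eom` word, no defect, no anti-Hermitian row, no
residual word, zero filling multipliers) HOLDS — it is discharged inside the proofs below by `module`, with no hypothesis. Reading it:

* `IsTranslationInvariant.sub_le_mul_two_mul_re_expect_localPairAt_of_chord_certificate` — through the TI-class field-rows reader
  (cap row a premise on `ω`: `e^{src}_h(ω) ≤ u`; floor row state-free: `ℓ₁ ≤ E(h₁)`): `ℓ₁ − u ≤ (h − h₁)·2 Re ω(P₀^d)` for every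
  translation-invariant `ω` with `e^{src}_h(ω) ≤ u` — the SAME inequality as the tree's direct bracket
  `InfVolFermionState.div_le_pairAmplitude_of_bounds`;
* `IsMeanEnergyMinimiser.sub_le_mul_two_mul_re_expect_localPairAt_of_chord_certificate` — through the ground-state-class reader
  (`…_kkt_fieldRows`, cap row discharged by `E(h) ≤ u` on the class): the same for every translation-invariant ground state of
  `Φ − μn − hP_d`; `…div_le_re_expect_localPairAt_of_chord_certificate`: for `h₁ < h` the cell's chord floor
  `(ℓ₁ − u)/(2(h − h₁)) ≤ Re ω(P₀^d)`;
* `sub_div_le_neg_leftDeriv_of_chord_certificate` — STATE-FREE: `(ℓ₁ − u)/(h − h₁) ≤ −∂⁻E(h)`, `E = dWaveSourceEnergyDensityTT' t' U μ`.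

So the readers' constants (`κ`, `c`, the factor `2`, the orbit average `1/32`) are the right ones and their identity hypothesis is
satisfiable (non-vacuity). Consequence for the cell's «chord ⊕ KKT» legs (CONSUMER-GRAMMAR §12): a K-leg that carries the cap row at `h`
and a certified floor row at `h₁` contains this certificate as a feasible dual point, so its optimum is `≥` the chord floor of record.
HONEST FRAMING (cell hubbard-cq): a unit test / consistency theorem; no new number, no order parameter, no phase word. Everything is PROVED;
no definition, no named fact, no `sorry`. Tree search: `lean search 'chord_certificate'` — nothing; REUSED `FermionInteraction.meanEnergyObs_pencil`,
`meanEnergy_pairSourceInteraction_eq_two_mul_re_expect_localPairAt`, `sum_re_expect_localPairAt_dWave_twistedFlipAct`,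
`exists_isMeanEnergyMinimiser_two_mul_re_expect_localPairAt_eq_neg_leftDeriv`, `Matrix.PosSemidef.zero`.

References: R. B. Griffiths, Phys. Rev. 152 (1966) 240, §II (convexity brackets on conjugate densities) [cite: Griffiths1966, §II];
T. Koma, H. Tasaki, J. Stat. Phys. 76 (1994) 745, §1 [cite: KomaTasaki1994, §1]; J. Wang et al., PRX 14 (2024) 031006, §III
[cite: WangEtAl2024, §III]; O. Bratteli, A. Kishimoto, D. W. Robinson, CMP 64 (1978) 41, §3 [cite: BratteliKishimotoRobinson1978, §3].
-/

noncomputable section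

namespace Literature.MathematicalPhysics.QuantumLattice

open Matrix Finset Complex HubbardWave0 Literature.Probability.LatticeModels Set
open Literature.MathematicalPhysics.QuantumManyBody.StateRelaxation
open scoped ComplexOrder BigOperators

/-! ## §1 The pencil at the operator level -/

/-- **`E^{src}_h = E^{μ} − h E_P` as window observables**: the mean-energy observable of the sourced interaction is affine in the
source, `(Φ − μn − hP_g).meanEnergyObs 1 = (Φ − μn).meanEnergyObs 1 + (−h) • P_g.meanEnergyObs 1`.
[cite: BratteliKishimotoRobinson1978, §3 (mean energy functional)] [cite: KomaTasaki1994, §1] -/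
theorem hubbardTTPrimeSourcedInteraction_meanEnergyObs (t t' U μ : ℝ) (g : Site 2 → ℝ) (h : ℝ) :
    (hubbardTTPrimeSourcedInteraction t t' U μ g h).meanEnergyObs 1 =
      (hubbardTTPrimeMuInteraction t t' U μ).meanEnergyObs 1 + ((-h : ℝ) : ℂ) • (pairSourceInteraction g).meanEnergyObs 1 := by
  rw [hubbardTTPrimeSourcedInteraction, FermionInteraction.meanEnergyObs_pencil]

/-- **`Γ E^{src}_{h₁} − Γ E^{src}_{h} = (h − h₁) • Γ E_P`** in every window containing `thicken {0} 1`: the difference of the sourced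
mean-energy observables at two fields is the field difference times the pair-source observable. [cite: Griffiths1966, §II]
[cite: KomaTasaki1994, §1] -/
theorem fermionEmbed_meanEnergyObs_sourced_sub (t t' U μ : ℝ) (g : Site 2 → ℝ) (h h₁ : ℝ) {Λ' : Finset (Site 2)}
    (h0 : thicken ({0} : Finset (Site 2)) 1 ⊆ Λ') :
    fermionEmbed (PolySite.incl h0) ((hubbardTTPrimeSourcedInteraction t t' U μ g h₁).meanEnergyObs 1) -
        fermionEmbed (PolySite.incl h0) ((hubbardTTPrimeSourcedInteraction t t' U μ g h).meanEnergyObs 1) =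
      ((h - h₁ : ℝ) : ℂ) • fermionEmbed (PolySite.incl h0) ((pairSourceInteraction g).meanEnergyObs 1) := by
  rw [hubbardTTPrimeSourcedInteraction_meanEnergyObs, hubbardTTPrimeSourcedInteraction_meanEnergyObs, map_add, map_add, map_smul,
    map_smul]
  push_cast
  module

/-- **`Re ω(Γ E_P) = 2 Re ω(P₀^d)`** in every state (`E_P` embedded in any window containing `thicken {0} 1`).
[cite: KomaTasaki1994, §1] -/
theorem InfVolFermionState.re_expect_fermionEmbed_meanEnergyObs_pairSource_dWave (ω : InfVolFermionState 2)
    {Λ' : Finset (Site 2)} (h0 : thicken ({0} : Finset (Site 2)) 1 ⊆ Λ') :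
    (ω.expect Λ' (fermionEmbed (PolySite.incl h0) ((pairSourceInteraction dWaveFormFactor).meanEnergyObs 1))).re =
      2 * (ω.expect (pairRegion (insert (0 : Site 2) unitSteps) 0)
        (localPairAt (insert (0 : Site 2) unitSteps) dWaveFormFactor 0)).re := by
  rw [ω.compatible h0, ← meanEnergy_pairSourceInteraction_eq_two_mul_re_expect_localPairAt dWaveFormFactor dWaveFormFactor_neg_unitVec ω,
    InfVolFermionState.meanEnergy]

/-- **The orbit sum of the chord objective**: `Σ_g Re (α_g ω)((h − h₁) • Γ E_P) = 32 (h − h₁) · 2 Re ω(P₀^d)`.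
[cite: KomaTasaki1994, §1] -/
theorem InfVolFermionState.sum_re_twistedFlipAct_expect_chordObjective (ω : InfVolFermionState 2) (h h₁ : ℝ)
    {Λ' : Finset (Site 2)} (h0 : thicken ({0} : Finset (Site 2)) 1 ⊆ Λ') :
    ∑ g : TwistFlipIndex, ((ω.twistedFlipAct g).expect Λ'
        (((h - h₁ : ℝ) : ℂ) • fermionEmbed (PolySite.incl h0) ((pairSourceInteraction dWaveFormFactor).meanEnergyObs 1))).re =
      32 * ((h - h₁) * (2 * (ω.expect (pairRegion (insert (0 : Site 2) unitSteps) 0)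
        (localPairAt (insert (0 : Site 2) unitSteps) dWaveFormFactor 0)).re)) := by
  simp_rw [map_smul, smul_eq_mul, Complex.re_ofReal_mul, InfVolFermionState.re_expect_fermionEmbed_meanEnergyObs_pairSource_dWave,
    InfVolFermionState.twistedFlipAct_expect_localPairAt_dWave]
  rw [Finset.sum_const, Finset.card_univ, card_twistFlipIndex, nsmul_eq_mul, Nat.cast_ofNat]

/-! ## §2 The chord through the readers -/

namespace InfVolFermionState

variable {ω : InfVolFermionState 2} {t' U μ h : ℝ}

/-- **The chord through the TI-class reader** (no ground-state rows): for a translation-invariant `ω` with `e^{src}_h(ω) ≤ u` (the cap row,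
a premise on `ω`) and a certified `ℓ₁ ≤ E(h₁)` (the floor row, state-free), the field-rows reader applied to the chord certificate gives
`ℓ₁ − u ≤ (h − h₁) · 2 Re ω(P₀^d)` — the tree's `div_le_pairAmplitude_of_bounds`, re-derived through
`IsTranslationInvariant.re_sum_twistedFlipAct_expect_ge_of_sourced_certificate_fieldRows` with an identity proved on the spot.
[cite: Griffiths1966, §II] [cite: WangEtAl2024, §III] -/
theorem IsTranslationInvariant.sub_le_mul_two_mul_re_expect_localPairAt_of_chord_certificate (hω : ω.IsTranslationInvariant)
    {h₁ u ℓ₁ : ℝ} (hu : ω.meanEnergy (hubbardTTPrimeSourcedInteraction 1 t' U μ dWaveFormFactor h) 1 ≤ u)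
    (hℓ : ℓ₁ ≤ dWaveSourceEnergyDensityTT' t' U μ h₁) :
    ℓ₁ - u ≤ (h - h₁) * (2 * (ω.expect (pairRegion (insert (0 : Site 2) unitSteps) 0)
      (localPairAt (insert (0 : Site 2) unitSteps) dWaveFormFactor 0)).re) := by
  set T : Finset (Site 2) := thicken ({0} : Finset (Site 2)) 1 with hT
  have h0 : thicken ({0} : Finset (Site 2)) 1 ⊆ T := Finset.Subset.refl _
  have hΛ : ({0} : Finset (Site 2)) ⊆ T := subset_thicken _ _
  have hz : (0 : Site 2) ∈ T := hΛ (Finset.mem_singleton_self 0)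
  have hmain := hω.re_sum_twistedFlipAct_expect_ge_of_sourced_certificate_fieldRows t' U μ h hΛ h0 hz
    (((h - h₁ : ℝ) : ℂ) • fermionEmbed (PolySite.incl h0) ((pairSourceInteraction dWaveFormFactor).meanEnergyObs 1))
    1 0 u 0 (fun _ => 0) 0 (by rw [one_mul, one_mul]; exact hu) (fun _ _ _ => by simp only [zero_mul, le_refl])
    (Finset.univ : Finset Unit) (fun _ => 1) (fun _ => h₁) (fun _ => ℓ₁)
    (fun σ hσ _ j _ => mul_le_mul_meanEnergy_sourced_of_dWaveSourceEnergyDensityTT'_ge zero_le_one hℓ σ hσ)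
    (m := Fin 0) (Λm := 0) Matrix.PosSemidef.zero (fun _ => 0)
    (ι := Fin 0) ∅ Fin.elim0 Fin.elim0 Fin.elim0 Fin.elim0 (fun l => l.elim0) Fin.elim0 Fin.elim0
    (δ := Fin 0) ∅ Fin.elim0 Fin.elim0 (κ'' := Fin 0) ∅ Fin.elim0 Fin.elim0 (c := ℓ₁ - u) (by
      have hsub := fermionEmbed_meanEnergyObs_sourced_sub 1 t' U μ dWaveFormFactor h h₁ h0
      simp only [gramForm, Finset.univ_eq_empty, Finset.sum_empty, Finset.sum_const_zero, Complex.ofReal_zero, zero_smul,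
        sub_zero, add_zero, Fintype.univ_ofSubsingleton, Finset.sum_singleton, Complex.ofReal_one, one_smul]
      rw [(sub_eq_iff_eq_add.1 hsub)]
      push_cast
      module)
  rw [ω.sum_re_twistedFlipAct_expect_chordObjective h h₁ h0] at hmain
  simp only [Finset.sum_empty, sub_zero, Finset.sum_const_zero, zero_mul, add_zero] at hmain
  linarith

/-- **The chord through the GROUND-STATE-class reader**: for every translation-invariant ground state `ω` of `Φ − μn − hP_d`, certified
`E(h) ≤ u` (cap row, discharged on the class) and `ℓ₁ ≤ E(h₁)` (floor row) give `ℓ₁ − u ≤ (h − h₁) · 2 Re ω(P₀^d)` — via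
`IsMeanEnergyMinimiser.re_sum_twistedFlipAct_expect_ge_of_sourced_certificate_kkt_fieldRows` with `0 × 0` ground-state blocks.
[cite: Griffiths1966, §II] [cite: WangEtAl2024, §III] -/
theorem IsMeanEnergyMinimiser.sub_le_mul_two_mul_re_expect_localPairAt_of_chord_certificate
    (hmin : ω.IsMeanEnergyMinimiser (hubbardTTPrimeSourcedInteraction 1 t' U μ dWaveFormFactor h) 1) {h₁ u ℓ₁ : ℝ}
    (hu : dWaveSourceEnergyDensityTT' t' U μ h ≤ u) (hℓ : ℓ₁ ≤ dWaveSourceEnergyDensityTT' t' U μ h₁) :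
    ℓ₁ - u ≤ (h - h₁) * (2 * (ω.expect (pairRegion (insert (0 : Site 2) unitSteps) 0)
      (localPairAt (insert (0 : Site 2) unitSteps) dWaveFormFactor 0)).re) := by
  set T : Finset (Site 2) := thicken ({0} : Finset (Site 2)) 1 with hT
  have h0 : thicken ({0} : Finset (Site 2)) 1 ⊆ T := Finset.Subset.refl _
  have hΛ : ({0} : Finset (Site 2)) ⊆ T := subset_thicken _ _
  have hz : (0 : Site 2) ∈ T := hΛ (Finset.mem_singleton_self 0)
  have hmain := hmin.re_sum_twistedFlipAct_expect_ge_of_sourced_certificate_kkt_fieldRows hΛ h0 h0 hz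
    (((h - h₁ : ℝ) : ℂ) • fermionEmbed (PolySite.incl h0) ((pairSourceInteraction dWaveFormFactor).meanEnergyObs 1))
    1 0 u 0 (fun _ => 0) 0 (hmin.mul_meanEnergy_sourced_le_of_le zero_le_one hu) (fun _ _ _ => by simp only [zero_mul, le_refl])
    (Finset.univ : Finset Unit) (fun _ => 1) (fun _ => h₁) (fun _ => ℓ₁)
    (fun σ hσ _ j _ => mul_le_mul_meanEnergy_sourced_of_dWaveSourceEnergyDensityTT'_ge zero_le_one hℓ σ hσ)
    (m := Fin 0) (Λm := 0) Matrix.PosSemidef.zero (fun _ => 0) (κ' := Fin 0) ∅ Fin.elim0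
    (ι := Fin 0) ∅ Fin.elim0 Fin.elim0 Fin.elim0 Fin.elim0 (fun l => l.elim0) Fin.elim0 Fin.elim0
    (δ := Fin 0) ∅ Fin.elim0 Fin.elim0 (κ'' := Fin 0) ∅ Fin.elim0 Fin.elim0
    (β := Fin 0) (G := 0) Matrix.PosSemidef.zero Fin.elim0 (c := ℓ₁ - u) (by
      have hsub := fermionEmbed_meanEnergyObs_sourced_sub 1 t' U μ dWaveFormFactor h h₁ h0
      simp only [gramForm, kktForm, Finset.univ_eq_empty, Finset.sum_empty, Finset.sum_const_zero, Complex.ofReal_zero, zero_smul,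
        sub_zero, add_zero, Fintype.univ_ofSubsingleton, Finset.sum_singleton, Complex.ofReal_one, one_smul]
      rw [(sub_eq_iff_eq_add.1 hsub)]
      push_cast
      module)
  rw [ω.sum_re_twistedFlipAct_expect_chordObjective h h₁ h0] at hmain
  simp only [Finset.sum_empty, sub_zero, Finset.sum_const_zero, zero_mul, add_zero] at hmain
  linarith

/-- **The cell's chord floor through the reader**: for `h₁ < h`, every translation-invariant ground state `ω` of `Φ − μn − hP_d` has
`(ℓ₁ − u)/(2(h − h₁)) ≤ Re ω(P₀^d)` whenever `E(h) ≤ u` and `ℓ₁ ≤ E(h₁)` are certified. [cite: Griffiths1966, §II] [cite: KomaTasaki1994, §1] -/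
theorem IsMeanEnergyMinimiser.div_le_re_expect_localPairAt_of_chord_certificate
    (hmin : ω.IsMeanEnergyMinimiser (hubbardTTPrimeSourcedInteraction 1 t' U μ dWaveFormFactor h) 1) {h₁ u ℓ₁ : ℝ} (hh : h₁ < h)
    (hu : dWaveSourceEnergyDensityTT' t' U μ h ≤ u) (hℓ : ℓ₁ ≤ dWaveSourceEnergyDensityTT' t' U μ h₁) :
    (ℓ₁ - u) / (2 * (h - h₁)) ≤ (ω.expect (pairRegion (insert (0 : Site 2) unitSteps) 0)
      (localPairAt (insert (0 : Site 2) unitSteps) dWaveFormFactor 0)).re := by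
  have hmain := hmin.sub_le_mul_two_mul_re_expect_localPairAt_of_chord_certificate hu hℓ
  have hpos : 0 < 2 * (h - h₁) := by linarith
  rw [div_le_iff₀ hpos]
  linarith

end InfVolFermionState

/-- **The chord floor on Griffiths' left edge, STATE-FREE, through the reader**: `(ℓ₁ − u)/(h − h₁) ≤ −∂⁻E(h)` for `h₁ < h`,
`E = dWaveSourceEnergyDensityTT' t' U μ`, from certified `E(h) ≤ u`, `ℓ₁ ≤ E(h₁)` (the ground state realising the left edge exists).
[cite: Griffiths1966, §II] [cite: KomaTasaki1994, §1] -/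
theorem sub_div_le_neg_leftDeriv_of_chord_certificate (t' U μ h : ℝ) {h₁ u ℓ₁ : ℝ} (hh : h₁ < h)
    (hu : dWaveSourceEnergyDensityTT' t' U μ h ≤ u) (hℓ : ℓ₁ ≤ dWaveSourceEnergyDensityTT' t' U μ h₁) :
    (ℓ₁ - u) / (h - h₁) ≤ -derivWithin (dWaveSourceEnergyDensityTT' t' U μ) (Iio h) h := by
  obtain ⟨ω₀, hmin, hω₀⟩ := exists_isMeanEnergyMinimiser_two_mul_re_expect_localPairAt_eq_neg_leftDeriv t' U μ h
  have hmain := hmin.sub_le_mul_two_mul_re_expect_localPairAt_of_chord_certificate hu hℓ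
  rw [hω₀] at hmain
  have hpos : 0 < h - h₁ := by linarith
  rw [div_le_iff₀ hpos]
  linarith

end Literature.MathematicalPhysics.QuantumLattice

end
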